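import Literature.Analysis.FluidPDE.ElgindiEllipticVeryWeak
import HarnessLib

/-!
# Locality of the slice derivatives, of `L` and of `ᵗL`
([Elgindi2021] §7, the polar operator `L` of (PolarBSL))

Topic `Literature/Analysis/FluidPDE`. Proof file (everything proved, no definitions, no named
facts) on the proof path of the named fact
`Literature.Analysis.FluidPDE.Elgindi.ElgindiGhoulMasmoudi2021_stabilityCore`
(`ElgindiStabilityDecomposition.lean`). T. M. Elgindi, Ann. of Math. 194 (2021) =
arXiv:1904.04795, §7 eq. (PolarBSL) (p. 19 of the held text).

Functions agreeing on an open set have the same slice derivatives there (`eqOn_dz`, `eqOn_dθ`),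
hence the same `L` (`eqOn_ellipticOp`) and `ᵗL` (`eqOn_transposeOp`); `ᵗL(Φ)` vanishes off the
support of `Φ` (`transposeOp_eq_zero_of_notMem`). Used to localise test functions (plateau cutoffs
in `θ`) in the very weak formulations.
-/

noncomputable section

open MeasureTheory Set Real Filter Function
open _root_.Topology

namespace Literature.Analysis.FluidPDE

namespace Elgindi

/-! ### Locality of the slice derivatives and of `L` -/

/-- `∂_R` is local: functions agreeing on an open set have the same `∂_R` there. [folklore] -/
theorem eqOn_dz {f g : ℝ → ℝ → ℝ} {W : Set (ℝ × ℝ)} (hW : IsOpen W) (h : ∀ q ∈ W, f q.1 q.2 = g q.1 q.2)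
    {p : ℝ × ℝ} (hp : p ∈ W) : dz f p.1 p.2 = dz g p.1 p.2 := by
  unfold dz
  apply Filter.EventuallyEq.deriv_eq
  have ht : Tendsto (fun t : ℝ => (t, p.2)) (𝓝 p.1) (𝓝 p) := by
    have : Continuous fun t : ℝ => (t, p.2) := by fun_prop
    simpa using this.tendsto p.1
  filter_upwards [ht (hW.mem_nhds hp)] with t hts using h _ hts

/-- `∂_θ` is local. [folklore] -/
theorem eqOn_dθ {f g : ℝ → ℝ → ℝ} {W : Set (ℝ × ℝ)} (hW : IsOpen W) (h : ∀ q ∈ W, f q.1 q.2 = g q.1 q.2)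
    {p : ℝ × ℝ} (hp : p ∈ W) : dθ f p.1 p.2 = dθ g p.1 p.2 := by
  unfold dθ
  apply Filter.EventuallyEq.deriv_eq
  have ht : Tendsto (fun t : ℝ => (p.1, t)) (𝓝 p.2) (𝓝 p) := by
    have : Continuous fun t : ℝ => (p.1, t) := by fun_prop
    simpa using this.tendsto p.2
  filter_upwards [ht (hW.mem_nhds hp)] with t hts using h _ hts

/-- `L` is local. [folklore] -/
theorem eqOn_ellipticOp (α : ℝ) {f g : ℝ → ℝ → ℝ} {W : Set (ℝ × ℝ)} (hW : IsOpen W) (h : ∀ q ∈ W, f q.1 q.2 = g q.1 q.2)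
    {p : ℝ × ℝ} (hp : p ∈ W) : ellipticOp α f p.1 p.2 = ellipticOp α g p.1 p.2 := by
  have h1 : ∀ q ∈ W, dz f q.1 q.2 = dz g q.1 q.2 := fun q hq => eqOn_dz hW h hq
  have h2 : ∀ q ∈ W, dθ f q.1 q.2 = dθ g q.1 q.2 := fun q hq => eqOn_dθ hW h hq
  have h3 : ∀ q ∈ W, (fun R θ => Real.tan θ * f R θ) q.1 q.2 = (fun R θ => Real.tan θ * g R θ) q.1 q.2 := fun q hq => by
    show Real.tan q.2 * f q.1 q.2 = Real.tan q.2 * g q.1 q.2; rw [h q hq]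
  unfold ellipticOp
  rw [eqOn_dz (f := dz f) (g := dz g) hW h1 hp, h1 p hp, eqOn_dθ (f := dθ f) (g := dθ g) hW h2 hp,
    eqOn_dθ (f := fun R θ => Real.tan θ * f R θ) (g := fun R θ => Real.tan θ * g R θ) hW h3 hp, h p hp]

/-- `ᵗL(Φ)` vanishes off the support of `Φ`. [folklore] -/
theorem transposeOp_eq_zero_of_notMem (α : ℝ) {Φ : ℝ → ℝ → ℝ} {p : ℝ × ℝ} (hp : p ∉ tsupport (uncurry Φ)) :
    transposeOp α Φ p = 0 := by
  have hW : IsOpen (tsupport (uncurry Φ))ᶜ := (isClosed_tsupport _).isOpen_compl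
  set Z : ℝ → ℝ → ℝ := fun _ _ => 0 with hZ
  have hZ0 : ∀ q : ℝ × ℝ, Z q.1 q.2 = 0 := fun q => rfl
  have hdzZ : ∀ q : ℝ × ℝ, dz Z q.1 q.2 = 0 := fun q => by simp [hZ, dz]
  have hdθZ : ∀ q : ℝ × ℝ, dθ Z q.1 q.2 = 0 := fun q => by simp [hZ, dθ]
  have h0 : ∀ q ∈ (tsupport (uncurry Φ))ᶜ, Φ q.1 q.2 = Z q.1 q.2 := fun q hq => by
    have := image_eq_zero_of_notMem_tsupport hq
    exact this
  have h1 : ∀ q ∈ (tsupport (uncurry Φ))ᶜ, dz Φ q.1 q.2 = Z q.1 q.2 := fun q hq => by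
    rw [eqOn_dz (f := Φ) (g := Z) hW h0 hq, hdzZ q, hZ0 q]
  have h2 : ∀ q ∈ (tsupport (uncurry Φ))ᶜ, dθ Φ q.1 q.2 = Z q.1 q.2 := fun q hq => by
    rw [eqOn_dθ (f := Φ) (g := Z) hW h0 hq, hdθZ q, hZ0 q]
  rw [transposeOp_apply, eqOn_dz (f := dz Φ) (g := Z) hW h1 hp, eqOn_dθ (f := dθ Φ) (g := Z) hW h2 hp, h1 p hp, h2 p hp,
    h0 p hp, hdzZ p, hdθZ p, hZ0 p]
  ring

/-- `ᵗL` is local. [folklore] -/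
theorem eqOn_transposeOp (α : ℝ) {f g : ℝ → ℝ → ℝ} {W : Set (ℝ × ℝ)} (hW : IsOpen W) (h : ∀ q ∈ W, f q.1 q.2 = g q.1 q.2)
    {p : ℝ × ℝ} (hp : p ∈ W) : transposeOp α f p = transposeOp α g p := by
  have h1 : ∀ q ∈ W, dz f q.1 q.2 = dz g q.1 q.2 := fun q hq => eqOn_dz hW h hq
  have h2 : ∀ q ∈ W, dθ f q.1 q.2 = dθ g q.1 q.2 := fun q hq => eqOn_dθ hW h hq
  rw [transposeOp_apply, transposeOp_apply, eqOn_dz (f := dz f) (g := dz g) hW h1 hp, h1 p hp,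
    eqOn_dθ (f := dθ f) (g := dθ g) hW h2 hp, h2 p hp, h p hp]

end Elgindi

end Literature.Analysis.FluidPDE
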